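import Summits.NavierStokesRegularity.NavierStokesRegularity.Theorems.HubbleDynamoFarFieldSlavingTwoPointZoom
import Summits.NavierStokesRegularity.NavierStokesRegularity.Theses.HubbleDynamo
import Summits.NavierStokesRegularity.NavierStokesRegularity.Theses.ClockStretchingLaw
import HarnessLib

/-!
# Crux `HubbleDynamo.FarFieldSlaving` (stmt-NavierStokesRegularity-1935) from TWO-POINT RIGIDITY of
# singular Type-I models (lead c3, the two-point reduction)

`hubbleDynamo_farFieldSlaving_of_twoPointRigidity`: the route statement `FarFieldSlaving` (Type I in
time ⇒ every point is a space–time Type-I centre) follows from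

  (R2) every Type-I KNSS-mild ancient field `ū ∈ 𝒦_C` (`IsTypeIAncientMild C ū`, scaled energies
  `A, E ≤ C` on all backward cylinders with vertex time `≤ 0` — verbatim the class of
  `ClockStretchingLaw.NoSingularTypeIModel`, stmt-NavierStokesRegularity-10569) which is unbounded
  at the space–time origin is bounded near every other final-time point `(0, e)`, `e ≠ 0`

("no two mutually receding Type-I singularities": in the similarity variables about one singular
point a second one rides the Hubble outflow `V = U + a y` to `|y| = ∞` without decaying — exactly
what the route's dilution picture forbids). At a backward-regular `x₀` the bound is elementary
(`hubbleDynamo_farFieldSlavingAt_of_essBounded`); at a singular `x₀` a violation at every radius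
yields, by `hubbleDynamo_exists_twoPointModel`, an element of `𝒦_C` singular at the origin and
unbounded near some `(0, e)`, `e ≠ 0`. R2 is implied by `NoSingularTypeIModel`
(`hubbleDynamo_twoPointRigidity_of_noSingularTypeIModel`), so this refines the recorded chain
`NoSingularTypeIModel ⟹ NoTypeIBlowup ⟹ FarFieldSlaving` (`HubbleDynamoFarFieldSlavingConditional`)
through a weaker, route-specific intermediate statement; unlike `NoTypeIBlowup` it does not ask
that Type-I blow-up be excluded, only that Type-I singular points of ancient models be isolated
in the strong (non-accumulating, non-coexisting at unit distance) sense.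
-/

noncomputable section

set_option linter.dupNamespace false

open MeasureTheory Set Function Filter TopologicalSpace Metric
open scoped Topology NNReal ENNReal InnerProductSpace RealInnerProductSpace

namespace Summit.NavierStokesRegularity.NavierStokesRegularity.Theorems

open Literature.Analysis Literature.Analysis.FluidPDE

section Main

/-- **Far-field slaving at a backward-REGULAR point** (the easy case): if `u` is essentially
bounded on some backward cylinder `Q_r(T, x₀)`, then `‖u t x‖ ≤ C / (‖x − x₀‖ + √(T − t))` on
`Q_δ(T, x₀)` with `δ = min r √T` and `C = 2δ ‖u‖_{L^∞(Q_δ)}` (continuity below `T` turns the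
essential bound into a pointwise one; the denominator is `≤ 2δ`). [folklore] -/
theorem hubbleDynamo_farFieldSlavingAt_of_essBounded {ν T : ℝ} (hT : 0 < T)
    {u : ℝ → EuclideanSpace ℝ (Fin 3) → EuclideanSpace ℝ (Fin 3)}
    {p : ℝ → EuclideanSpace ℝ (Fin 3) → ℝ} (hsol : IsClassicalNSSolutionOn (Ico 0 T) ν 0 u p)
    (x₀ : EuclideanSpace ℝ (Fin 3)) {r : ℝ} (hr : 0 < r)
    (hfin : eLpNorm (uncurry u) ∞ (volume.restrict (parabolicCylinder r ((T : ℝ), x₀))) ≠ ∞) :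
    ∃ δ : ℝ, 0 < δ ∧ ∃ C : ℝ, ∀ t ∈ Set.Ioo (T - δ ^ 2) T, ∀ x ∈ Metric.ball x₀ δ,
      ‖u t x‖ ≤ C / (‖x - x₀‖ + Real.sqrt (T - t)) := by
  set δ : ℝ := min r (Real.sqrt T) with hδ
  have hδpos : 0 < δ := lt_min hr (Real.sqrt_pos.2 hT)
  have hδr : δ ≤ r := min_le_left _ _
  have hδT : δ ^ 2 ≤ T := by
    have h1 : δ ≤ Real.sqrt T := min_le_right _ _
    calc δ ^ 2 ≤ Real.sqrt T ^ 2 := pow_le_pow_left₀ hδpos.le h1 2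
      _ = T := Real.sq_sqrt hT.le
  -- the smaller cylinder, inside the big one and below `T` after time `0`
  have hsub : parabolicCylinder δ ((T : ℝ), x₀) ⊆ parabolicCylinder r ((T : ℝ), x₀) := by
    intro z hz
    rw [mem_parabolicCylinder] at hz ⊢
    have h2 : δ ^ 2 ≤ r ^ 2 := pow_le_pow_left₀ hδpos.le hδr 2
    exact ⟨⟨by linarith [hz.1.1], hz.1.2⟩, hz.2.trans_le hδr⟩
  have hslab : parabolicCylinder δ ((T : ℝ), x₀) ⊆ Ico 0 T ×ˢ (univ : Set (EuclideanSpace ℝ (Fin 3))) := by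
    intro z hz
    rw [mem_parabolicCylinder] at hz
    exact ⟨⟨by linarith [hz.1.1], hz.1.2⟩, mem_univ _⟩
  set S : ℝ≥0∞ := eLpNorm (uncurry u) ∞ (volume.restrict (parabolicCylinder δ ((T : ℝ), x₀))) with hS
  have hStop : S ≠ ∞ := by
    refine ne_top_of_le_ne_top hfin ?_
    exact eLpNorm_mono_measure _ (Measure.restrict_mono hsub le_rfl)
  have hcont : ContinuousOn (uncurry u) (parabolicCylinder δ ((T : ℝ), x₀)) :=
    hsol.smooth_velocity.continuousOn.mono hslab
  -- the pointwise bound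
  have hpt : ∀ t ∈ Set.Ioo (T - δ ^ 2) T, ∀ x ∈ Metric.ball x₀ δ, ‖u t x‖ ≤ S.toReal := by
    intro t ht x hx
    have hmem : ((t, x) : ℝ × EuclideanSpace ℝ (Fin 3)) ∈ parabolicCylinder δ ((T : ℝ), x₀) := by
      rw [mem_parabolicCylinder]
      exact ⟨ht, hx⟩
    have hle := enorm_le_eLpNorm_top_of_continuousOn_isOpen
      (μ := (volume : Measure (ℝ × EuclideanSpace ℝ (Fin 3))))
      (isOpen_parabolicCylinder δ ((T : ℝ), x₀)) hcont hmem
    have h2 := ENNReal.toReal_mono hStop hle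
    rwa [uncurry_apply_pair, toReal_enorm] at h2
  refine ⟨δ, hδpos, 2 * δ * S.toReal, fun t ht x hx => ?_⟩
  have hK0 : 0 ≤ S.toReal := ENNReal.toReal_nonneg
  have hTt : 0 < T - t := sub_pos.2 ht.2
  have hsq : Real.sqrt (T - t) ≤ δ := by
    calc Real.sqrt (T - t) ≤ Real.sqrt (δ ^ 2) := Real.sqrt_le_sqrt (by linarith [ht.1])
      _ = δ := Real.sqrt_sq hδpos.le
  have hxδ : ‖x - x₀‖ < δ := by rw [← dist_eq_norm]; exact hx
  have hDpos : 0 < ‖x - x₀‖ + Real.sqrt (T - t) :=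
    add_pos_of_nonneg_of_pos (norm_nonneg _) (Real.sqrt_pos.2 hTt)
  have hD : ‖x - x₀‖ + Real.sqrt (T - t) ≤ 2 * δ := by linarith
  calc ‖u t x‖ ≤ S.toReal := hpt t ht x hx
    _ = 2 * δ * S.toReal / (2 * δ) := by field_simp
    _ ≤ 2 * δ * S.toReal / (‖x - x₀‖ + Real.sqrt (T - t)) :=
        div_le_div_of_nonneg_left (by positivity) hDpos hD

/-- **TWO-POINT RIGIDITY OF SINGULAR TYPE-I MODELS IMPLIES THE CRUX `FarFieldSlaving`**
(lead c3, the two-point reduction). Hypothesis (R2, "no two mutually receding self-excited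
dynamos"): every Type-I KNSS-mild ancient field `ū ∈ 𝒦_C` — `IsTypeIAncientMild C ū` with the
scale-invariant energies `A, E ≤ C` on all backward cylinders with vertex time `≤ 0`, EXACTLY the
class of `ClockStretchingLaw.NoSingularTypeIModel` / `SqueezeCycle.SingularZoom` — which is
unbounded at the space–time origin is bounded near every other final-time point `(0, e)`, `e ≠ 0`.
Conclusion: the route statement `HubbleDynamo.FarFieldSlaving`, verbatim. Proof: at a
backward-regular `x₀` the bound is `hubbleDynamo_farFieldSlavingAt_of_essBounded`; at a singular
`x₀`, if the bound failed at every radius, `hubbleDynamo_exists_twoPointModel` would produce an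
element of `𝒦_C` singular at the origin and unbounded near some `(0, e)`, `e ≠ 0`, against R2.
R2 is implied by `NoSingularTypeIModel` (stmt-10569,
`hubbleDynamo_twoPointRigidity_of_noSingularTypeIModel`) and is the statement the route's
"Hubble dilution" picture actually asserts in the ancient class: a second Type-I singularity
riding the outflow `V = U + a y` to `|y| = ∞` is excluded. [cite: AlbrittonBarker2019, §3 and Prop. 2.3; KochNadirashviliSereginSverak2009, Thm 6.2 (arXiv pp. 12–13)] -/
theorem hubbleDynamo_farFieldSlaving_of_twoPointRigidity :
    (∀ (C : ℝ) (ū : ℝ → EuclideanSpace ℝ (Fin 3) → EuclideanSpace ℝ (Fin 3)),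
      Literature.Analysis.FluidPDE.IsTypeIAncientMild C ū →
      (∀ (x₁ : EuclideanSpace ℝ (Fin 3)) (t₀ r : ℝ), t₀ ≤ 0 → 0 < r →
        (∀ t, t₀ - r ^ 2 < t → t < t₀ → r⁻¹ * ∫ x in Metric.ball x₁ r, ‖ū t x‖ ^ 2 ≤ C) ∧
        r⁻¹ * ∫ t in Set.Ioo (t₀ - r ^ 2) t₀, ∫ x in Metric.ball x₁ r,
          ‖fderiv ℝ (ū t) x‖ ^ 2 ≤ C) →
      (∀ r > 0, ∀ M : ℝ, ∃ t ∈ Set.Ioo (-(r ^ 2)) (0 : ℝ),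
        ∃ x ∈ Metric.ball (0 : EuclideanSpace ℝ (Fin 3)) r, M < ‖ū t x‖) →
      ∀ e : EuclideanSpace ℝ (Fin 3), e ≠ 0 → ∃ r > 0, ∃ M : ℝ,
        ∀ t ∈ Set.Ioo (-(r ^ 2)) (0 : ℝ), ∀ x ∈ Metric.ball e r, ‖ū t x‖ ≤ M) →
    Summit.NavierStokesRegularity.NavierStokesRegularity.Theses.HubbleDynamo.FarFieldSlaving := by
  intro hR2 ν T hν hT u p hsol hLH hdec hTI x₀
  by_cases hsing : ∀ r : ℝ, 0 < r →
      eLpNorm (uncurry u) ∞ (volume.restrict (parabolicCylinder r ((T : ℝ), x₀))) = ∞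
  · -- singular point: two-point model against R2
    by_contra hfail
    push Not at hfail
    obtain ⟨C, ū, e, he, hclass, hen, h0, hE⟩ :=
      hubbleDynamo_exists_twoPointModel ν T hν hT u p hsol hLH hdec hTI x₀ hsing hfail
    obtain ⟨r, hr, M, hM⟩ := hR2 C ū hclass hen h0 e he
    obtain ⟨t, ht, x, hx, hlt⟩ := hE r hr M
    exact absurd (hM t ht x hx) (not_le.2 hlt)
  · -- regular point
    push Not at hsing
    obtain ⟨r, hr, hne⟩ := hsing
    exact hubbleDynamo_farFieldSlavingAt_of_essBounded hT hsol x₀ hr hne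

/-- **`NoSingularTypeIModel` (stmt-NavierStokesRegularity-10569) implies two-point rigidity**
(trivially: the class has no element unbounded at the origin), so the two-point reduction
refines the chain `NoSingularTypeIModel ⟹ NoTypeIBlowup ⟹ FarFieldSlaving` of
`HubbleDynamoFarFieldSlavingConditional.lean` through a WEAKER intermediate statement. [folklore] -/
theorem hubbleDynamo_twoPointRigidity_of_noSingularTypeIModel
    (hX : Summit.NavierStokesRegularity.NavierStokesRegularity.Theses.ClockStretchingLaw.NoSingularTypeIModel) :
    ∀ (C : ℝ) (ū : ℝ → EuclideanSpace ℝ (Fin 3) → EuclideanSpace ℝ (Fin 3)),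
      IsTypeIAncientMild C ū →
      (∀ (x₁ : EuclideanSpace ℝ (Fin 3)) (t₀ r : ℝ), t₀ ≤ 0 → 0 < r →
        (∀ t, t₀ - r ^ 2 < t → t < t₀ → r⁻¹ * ∫ x in ball x₁ r, ‖ū t x‖ ^ 2 ≤ C) ∧
        r⁻¹ * ∫ t in Ioo (t₀ - r ^ 2) t₀, ∫ x in ball x₁ r, ‖fderiv ℝ (ū t) x‖ ^ 2 ≤ C) →
      (∀ r > 0, ∀ M : ℝ, ∃ t ∈ Ioo (-(r ^ 2)) (0 : ℝ),
        ∃ x ∈ ball (0 : EuclideanSpace ℝ (Fin 3)) r, M < ‖ū t x‖) →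
      ∀ e : EuclideanSpace ℝ (Fin 3), e ≠ 0 → ∃ r > 0, ∃ M : ℝ,
        ∀ t ∈ Ioo (-(r ^ 2)) (0 : ℝ), ∀ x ∈ ball e r, ‖ū t x‖ ≤ M := by
  intro C ū hclass hen h0 e _
  obtain ⟨h1, h2, h3, h4⟩ := (isTypeIAncientMild_iff).1 hclass
  exact absurd h0 (hX C ū ⟨h1, h2, fun s t hst ht x => h3 s t hst ht x, h4, hen⟩)

/-- **Corollary: the crux from `NoSingularTypeIModel` through the two-point reduction** (a second,
independent proof of `hubbleDynamo_farFieldSlaving_of_noSingularTypeIModel`, not passing through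
`NoTypeIBlowup`). [folklore] -/
theorem hubbleDynamo_farFieldSlaving_of_noSingularTypeIModel_twoPoint
    (hX : Summit.NavierStokesRegularity.NavierStokesRegularity.Theses.ClockStretchingLaw.NoSingularTypeIModel) :
    Summit.NavierStokesRegularity.NavierStokesRegularity.Theses.HubbleDynamo.FarFieldSlaving :=
  hubbleDynamo_farFieldSlaving_of_twoPointRigidity
    (hubbleDynamo_twoPointRigidity_of_noSingularTypeIModel hX)

end Main

end Summit.NavierStokesRegularity.NavierStokesRegularity.Theorems

end
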